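import Literature.MathematicalPhysics.QuantumFieldTheory.Balaban1983to89.B9Eq3153FrakGkBoundDiagonal
import Literature.MathematicalPhysics.QuantumFieldTheory.Balaban1983to89.B9Eq386GreenLipschitzEnergyClosed
import Literature.MathematicalPhysics.QuantumFieldTheory.Balaban1983to89.B9Eq3126H1kLipschitzEnergyClosed
import Literature.MathematicalPhysics.QuantumFieldTheory.Balaban1983to89.B9Eq3153FrakGkLipschitzEnergyClosed
import Literature.MathematicalPhysics.QuantumFieldTheory.Balaban1983to89.B9Eq325RLipschitzSqrtTowerPackaged

/-!
# `Balaban1983to89.B9Eq3126EnergyBallTowerClosed` — T. Bałaban, *Propagators for lattice gauge theories in a background field*, Commun. Math. Phys. **99**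
# (1985) 389–434 [Balaban1985BackgroundPropagators] Thm 3.4 p. 400, Thm 3.11 p. 416, (3.126) p. 420, Thm 3.13 p. 426 with (3.153) p. 426, and
# [Balaban1985Variational] (45)–(46) p. 285, (110)–(111) p. 294: THE `k`-LEVEL BALL IN THE ENERGY CURRENCY ON PRINT's DIAGONAL `ηL^{n+1} = 1` —
# the four letters `G_k(U)`, `H_k(U)Q_k(U)G_k(U)`, `𝔊_k(U)`, `H_k(U)` BOUNDED and (`G_k`, `𝔊_k`, `H_k`) LIPSCHITZ AT THE FLAT POINT in the flat energy norm,
# ONE `∃ α₀ C` BEFORE EVERY BINDER, EVERY OPERATOR LETTER INHABITED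

statement-level skeleton of published theorems with citation tags; proofs where landed; nothing here is a claim about the Yang–Mills mass gap

CITATION HEADER (lean-in-tree rule).  Audit cell `pub-balaban`, sub-cell `t4`, BINDER row NE9; filed by the row OWNER lineage `b2b-balaban-t4-ne9-p1`
(gen 87; plan v6 «the junction», `g86/ENERGY-PROGRAMME.md` §5 (b1)).  Sources READ by this lineage in the held texts: [Balaban1985BackgroundPropagators]
pp. 395–397, 400, 404–407, 416, 420, 426 (`paper:balaban1985-cmp99-background-propagators`, journal page = PDF page + 388); [Balaban1985Variational]
pp. 285, 293–295 (`paper:balaban1985-cmp102-variational-background`).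

THE PRINT (verbatim).  p. 426, Thm 3.13: *«… the operators 𝔓, 𝔊 … (3.147), (3.153) permit us to reduce properties of 𝔓, 𝔊 to the corresponding
properties of G′, (Q′G′²Q′*)⁻¹, G₁, (QG₁Q*)⁻¹»*; p. 400, Thm 3.4: *«G(U) is an analytic function of U′ on the space of configurations U′ satisfying
(3.35)»*; p. 420, (3.126): *«HB = GQ*(QGQ*)⁻¹B»*; [Balaban1985Variational] p. 295 L7–L9: *«By Theorem 3.13 of [5] the norm max{| |_(−1), |∇ |_(−2)}
of the transformation can be estimated by [(117)] if ε₄ + B₀|B| ≤ a₃»* — print's `B₀` is ONE constant for all the letters of the transformation (116),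
uniform in the lattice.

WHY THIS FILE (cell context).  Generations 83–86 of this lineage and the NE9 leaves 02∕03∕04 moved every letter of the `k`-level chart of `cur U`
(`Support/NE9CurChartTowerUniformBall` ← `B9Eq3126H1BoundTower.exists_H1k_frakGk_bound_of_small_field′`, whose `C_H`, `C_G` carry `‖Δ_a‖ ∝ |η|⁻²`,
the adjoint modulus of `Q_k` and `‖D‖ ∝ |η|⁻¹` — D-ne9p1-g85-1, D-ne9p1-g86-1∕-2) into the `L²`∕ENERGY currency on the diagonal, in NINE separate
`∃`-first theorems with three displayed letters `C_R`, `C_{K,1}`, `C_{K,U}` closed by three further files.  This file is the JUNCTION: ONE theorem, ONE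
`∃ α₀ C`, the seven row-groups, NO operator letter displayed — the name the chart consumer's re-wiring ((117)'s norm comparison, `B11Eq117TransformationNorm`)
takes as input; after it the residual non-uniformity of the `k`-level ball is EXACTLY (117)'s volume factor `√(c₁#β)` and `M_∇ = 2|η|⁻¹` (print removes
them by Thm 3.13's DECAY — not available in the tree).

WHAT IS PROVED (sorry-free; no `def`, no `Prop` placeholder; no inequality of the paper asserted hypothesis-free).
* **`exists_energy_ball_diagonal_closed`** — there are `α₀, C > 0`, closed in `(d, a, L, M_φ, M_φ′, r, C_τ, ρ_w)`, such that for every `n` (`3 ≤ L^{n+1}`),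
  `η` (`ηL^{n+1} = 1`), `c₀, c₁` (`c₀(L^{n+1})^d = c₁`, `|η|^d∕c₀ ≤ ρ_w`), `m`, background `U` of E162's data `(αU, hα1, hU1, hreg)` which is unitary
  (`U(b)* = U(b)⁻¹`), `U(b) ∈ U1`, in the windows `‖U(b) − 1‖ ≤ αη`, `‖U(∂p) − 1‖ ≤ αη²`, `‖Ū^j(b) − 1‖ ≤ ε_j ≤ αr^j` (`0 ≤ α ≤ α₀`), and ANY positivity ∕
  onto witnesses `hposU hpos1 hQU hQ1` (inhabited on the diagonal by `B9Thm311LaplaceAkPositiveDiagonal` ∕ `B9Eq326OperatorTower.QkW_surjective`, carried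
  as binders so that consumers plug their own):
  [G] `‖G_k(U)y‖, ‖curl₁G_k(U)y‖, ‖div₁G_k(U)y‖ ≤ C‖y‖` and `‖G_k(U)y − G_k(1)y‖, ‖curl₁(…)‖, ‖div₁(…)‖ ≤ Cα‖y‖`;
  [HQG] the three rows of `H_k(U)(Q_k(U)(G_k(U)y)) ≤ C‖y‖`;
  [𝔊] `‖𝔊_k(U)x‖ + rows ≤ C‖x‖` and `‖𝔊_k(U)x − 𝔊_k(1)x‖ + rows ≤ Cα‖x‖`;
  [H] `‖H_k(U)b‖ + rows ≤ C‖b‖` and `‖H_k(U)b − H_k(1)b‖ + rows ≤ Cα‖b‖`.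
  MECHANISM: composition BY NAME, one `obtain` each — `B9Thm311LaplaceAkPositiveDiagonal.exists_norm_G1k_le_diagonal_closed` (mass row of `G_k`),
  `B9Eq3153FrakGkBoundDiagonal` §1 (the STRONG coercivity `γ₁N₁(x)² ≤ re⟨x, Δ_a x⟩` — used for THE ONLY NEW ESTIMATE here, the energy rows of `H_k(U)b`:
  `N₁(H_k(U)b) ≤ √(C_{K,U}∕γ₁)‖b‖` by `B9Eq3126H1LipschitzEnergy.weight_H1K_le`, i.e. `re⟨H b, Δ_a H b⟩ = re⟨b, K⁻¹b⟩ ≤ C_{K,U}‖b‖²`) ∕ §2 ∕ §3 ∕ §4,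
  NE9 leaf-02's `B9Eq3126H1BoundTowerVariational.exists_norm_KinvLatticeK_H1LatticeK_le_diagonal_closed` (`C_{K,U}`, mass row of `H_k`),
  NE9 leaf-04's `B9Eq386GreenLipschitzEnergyClosed.exists_norm_G1k_sub_flat_le_diagonal_letterfree`, NE9 leaf-02's
  `B9Eq3126H1kLipschitzEnergyClosed.exists_norm_H1k_sub_flat_le_closed` and `B9Eq3153FrakGkLipschitzEnergyClosed.exists_norm_frakGk_sub_flat_le_closed`
  (modulo `C_R`), NE9 leaf-03's `B9Eq325RLipschitzSqrtTowerPackaged.exists_norm_RofUk_sub_RofUk_one_le_diagonal` (the `R`-letter `C_R` PACKAGED, fed through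
  `B9Thm311SmallFieldCoercivityTowerClosed.hLb_of_hU1`); `hRS` and the symmetry of `Δ_a` from unitarity and the trace letters
  (`B9Eq310HessianHermitian.adTransportW_adjoint`, `B9Eq326OperatorTower.laplaceAk_isSymmetric`); `α₀` the minimum of ten ceilings, `C` the sum of nine constants.
HONEST SCOPE.  [folklore] composition by name + one Cauchy–Schwarz row; Thm 3.13's ∕ Thm 3.4's `L²`∕ENERGY clauses on the diagonal ONLY — NO kernel bound
(3.42)–(3.47), NO decay (Thm 3.10), NO Hölder norms, NOT the (N)-reading ((117)'s volume factor load-bearing there), FIRST order at the flat point only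
(no two general backgrounds — NE9 leaf-04's ladder; no analyticity; no Neumann series); the small-field WINDOWS (print's running axioms (3.35); the level
profile is DERIVED on the two-window class by NE9 leaf-03's `B7Eq43AveragedSmallnessLinearFeed` — not used here), E162's data, unitarity + the trace
letters, `ρ_w` and the witnesses stay HYPOTHESES; crude constants.  NOT summit progress (cell pub-balaban: NE9 NOT PRINTED ∕ NOT PROVED; «NE9 ⇐ the named
binders»; row WALLED ON A MODEL (O-NE9-1; #5 UNRULED); spine PROVED 0∕9; rung (B)+1 finite T⁴ — NOT infinite volume, NOT mass gap, NOT BetaPertH, NOT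
Clay).  HONEST DEPENDENCY (cell line): continuum YM on T⁴ ⇐ BetaPertH ∧ nine spine estimates (0/9 proved); BetaPertH ⇐ (D1) ∧ (D4) ∧ CAP+tail; G-an2-4
gates asym, D1 and NE2/3/4.  NEW file; nothing modified.  Net new unproved facts: 0.
-/

noncomputable section

open scoped InnerProductSpace ComplexConjugate BigOperators

namespace Literature.MathematicalPhysics.QuantumFieldTheory.Balaban1983to89.B9Eq3126EnergyBallTowerClosed

open B4Sect5Torus (TSite)
open B9SectCLatticeCarrier (Bond)
open B11Eq103H1Complex (SiteL2K BondL2K covDerivL2K covDivL2K laplaceALatticeK laplaceAK greenK G1LatticeK H1LatticeK frakGLatticeK KinvLatticeK H1K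
  KinvK adjoint_injective_of_surjective)
open B9Eq310HessianOperator (adTransportW hessOp covCurlL2K)
open B9Eq310HessianHermitian (adTransportW_adjoint)
open B9Eq310DeltaPrime (plaqHolU)
open B9Eq315QTorus (perCfg cornerSite)
open B9Eq315QTower (towerP UlevOf)
open B9Eq315QTowerFlat (perCfg_UlevOf_one_mem_U1 norm_Wcx_UlevOf_one_sub_one_le)
open B9Eq326OperatorTower (laplaceAk QkW RofUk laplaceAk_isSymmetric)
open B7Prop1Explicit (U1 Wcx boxVec)
open B9Thm311SmallFieldCoercivityTowerClosed (hLb_of_hU1)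
open B9Thm311LaplaceAkPositiveDiagonal (exists_norm_G1k_le_diagonal_closed)
open B9Eq3153FrakGkBoundDiagonal (exists_energy_letters_diagonal_closed exists_norm_G1k_rows_le_diagonal_closed
  exists_norm_H1k_Qk_G1k_le_diagonal_closed exists_norm_frakGk_le_diagonal_closed)
open B9Eq3126H1BoundTowerVariational (exists_norm_KinvLatticeK_H1LatticeK_le_diagonal_closed)
open B9Eq3126H1LipschitzEnergy (weight_H1K_le)
open B9Eq386GreenLipschitzEnergyClosed (exists_norm_G1k_sub_flat_le_diagonal_letterfree)
open B9Eq3126H1kLipschitzEnergyClosed (exists_norm_H1k_sub_flat_le_closed)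
open B9Eq3153FrakGkLipschitzEnergyClosed (exists_norm_frakGk_sub_flat_le_closed)
open B9Eq325RLipschitzSqrtTowerPackaged (exists_norm_RofUk_sub_RofUk_one_le_diagonal)

/-! ## §1 Arithmetic -/

/-- `x ≤ √S` from `0 ≤ x` and `x² ≤ S`. [folklore] -/
private theorem le_sqrt_of_sq_le {x S : ℝ} (hx : 0 ≤ x) (h : x ^ 2 ≤ S) : x ≤ Real.sqrt S := by
  calc x = Real.sqrt (x ^ 2) := (Real.sqrt_sq hx).symm
    _ ≤ Real.sqrt S := Real.sqrt_le_sqrt h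

/-- Weakening a row constant: `t ≤ Cᵢ·s`, `Cᵢ ≤ C`, `0 ≤ s` give `t ≤ C·s`. [folklore] -/
private theorem row_mono {t Ci C s : ℝ} (h : t ≤ Ci * s) (hC : Ci ≤ C) (hs : 0 ≤ s) : t ≤ C * s :=
  h.trans (mul_le_mul_of_nonneg_right hC hs)

/-- Weakening an α-linear row constant: `t ≤ Cᵢ·α·s`, `Cᵢ ≤ C`, `0 ≤ α`, `0 ≤ s` give `t ≤ C·α·s`. [folklore] -/
private theorem row_mono_lin {t Ci C α s : ℝ} (h : t ≤ Ci * α * s) (hC : Ci ≤ C) (hα : 0 ≤ α) (hs : 0 ≤ s) : t ≤ C * α * s :=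
  h.trans (mul_le_mul_of_nonneg_right (mul_le_mul_of_nonneg_right hC hα) hs)

/-! ## §2 The k-level ball in the energy currency on the diagonal -/

variable {d : ℕ} (hd : 1 ≤ d) (L : ℕ) [NeZero L] (hL : 1 ≤ L)
  {𝔸 : Type*} [NormedRing 𝔸] [NormedAlgebra ℂ 𝔸] [CompleteSpace 𝔸] [NormOneClass 𝔸] [StarRing 𝔸] [NormedStarGroup 𝔸] [StarModule ℂ 𝔸]
  {W : Type*} [NormedAddCommGroup W] [InnerProductSpace ℂ W] [FiniteDimensional ℂ W] (φ : W ≃ₗ[ℂ] 𝔸)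
  {Mφ Mφ' : ℝ} (hMφ : 0 ≤ Mφ) (hMφ' : 0 ≤ Mφ') (hφ : ∀ w, ‖φ w‖ ≤ Mφ * ‖w‖) (hφ' : ∀ X, ‖φ.symm X‖ ≤ Mφ' * ‖X‖)
  {a : ℝ} (ha : 0 < a) {r : ℝ} (hr0 : 0 ≤ r) (hr1 : r < 1)
  (τ : 𝔸 →ₗ[ℂ] ℂ) {Cτ : ℝ} (hτ : ∀ X, ‖τ X‖ ≤ Cτ * ‖X‖) (hCτ : 0 ≤ Cτ) {ρw : ℝ} (hρw : 0 ≤ ρw)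
  (hτ₁ : ∀ X : 𝔸, τ (star X) = conj (τ X)) (hτ₂ : ∀ X Y : 𝔸, τ (X * Y) = τ (Y * X))
  (hφτ : ∀ X Y : 𝔸, ⟪φ.symm X, φ.symm Y⟫_ℂ = τ (star X * Y))

include hd hMφ hMφ' hφ hφ' ha hr0 hr1 hτ hCτ hρw hτ₁ hτ₂ hφτ

-- deep definitional unfolding `G1LatticeK`∕`H1LatticeK`∕`KinvLatticeK` ↦ `greenK`∕`H1K`∕`KinvK` (as in `B9Eq3126H1kLipschitzEnergyDiagonal`)
set_option maxRecDepth 8192 in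
/-- **THE `k`-LEVEL BALL IN THE ENERGY CURRENCY ON THE DIAGONAL, EVERY OPERATOR LETTER INHABITED** — see the module header: ONE `∃ α₀ C` (closed in
`(d, a, L, M_φ, M_φ′, r, C_τ, ρ_w)`) before every lattice ∕ height ∕ weight ∕ volume ∕ background binder; then for unitary `U` in the three windows and ANY
witnesses `hposU hpos1 hQU hQ1`: [G] bounds and flat-point Lipschitz rows of `G_k`, [HQG] rows of `H_kQ_kG_k`, [𝔊] bounds and Lipschitz rows of `𝔊_k`,
[H] bounds and Lipschitz rows of `H_k`, all in the flat energy norm.  Composition by name of this lineage's and NE9 leaves 02∕03∕04's closed letters; the only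
new estimate is the energy row of `H_k(U)b` (`re⟨Hb, Δ_a Hb⟩ = re⟨b, K⁻¹b⟩`). [folklore]
[cite: Balaban1985BackgroundPropagators, Thm 3.4 p.400, Thm 3.11 p.416, (3.126) p.420, Thm 3.13 p.426, (3.153) p.426; Balaban1985Variational, (45)–(46) p.285, (110)–(111) p.294, (117) p.295] -/
theorem exists_energy_ball_diagonal_closed :
    ∃ α₀ C : ℝ, 0 < α₀ ∧ 0 < C ∧ ∀ (n : ℕ) (η : ℝ), η * (L : ℝ) ^ (n + 1) = 1 → 3 ≤ L ^ (n + 1) →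
      ∀ (c₀ c₁ : ℝ) [Fact (0 < c₀)] [Fact (0 < c₁)], c₀ * ((L : ℝ) ^ (n + 1)) ^ d = c₁ → |η| ^ d / c₀ ≤ ρw →
      ∀ (m : Fin d → ℕ) [∀ i, NeZero (m i)] (U : Bond d (towerP L m (n + 1)) → 𝔸ˣ) (αU : ℕ → ℝ) (hα1 : ∀ j, αU j ≤ 1 / 64)
        (hU1 : ∀ (j : ℕ) (x : B7Prop1Explicit.Site d) (κ : Fin d), perCfg (towerP L m (j + 1)) (UlevOf L m (n + 1) U j) x κ ∈ U1 𝔸)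
        (hreg : ∀ (j : ℕ) (y : TSite d (towerP L m j)) (κ : Fin d) (r : Fin d → Fin L),
          ‖((Wcx L (perCfg (towerP L m (j + 1)) (UlevOf L m (n + 1) U j)) (cornerSite L y) κ (boxVec L r) : 𝔸ˣ) : 𝔸) - 1‖ ≤ αU j)
        (εU : ℕ → ℝ), (∀ j, 0 ≤ εU j) → (∀ (j : ℕ) (b : Bond d (towerP L m (j + 1))), ‖(UlevOf L m (n + 1) U j b : 𝔸) - 1‖ ≤ εU j) →
      ∀ {α : ℝ}, 0 ≤ α → α ≤ α₀ →
        (∀ b, star (U b : 𝔸) = (((U b)⁻¹ : 𝔸ˣ) : 𝔸)) →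
        (∀ b, U b ∈ U1 𝔸) → (∀ b, ‖(U b : 𝔸) - 1‖ ≤ α * η) →
        (∀ p : B9SectCLatticeCarrier.Plaq d (towerP L m (n + 1)), ‖(plaqHolU U p : 𝔸) - 1‖ ≤ α * η ^ 2) →
        (∀ j < n + 1, εU j ≤ α * r ^ j) →
        ∀ (hposU : ∀ x : BondL2K ℂ d (towerP L m (n + 1)) c₀ W, x ≠ 0 →
            0 < RCLike.re ⟪x, laplaceAk L m n φ η U hL αU hα1 hU1 hreg τ (c₀ := c₀) (c₁ := c₁) a x⟫_ℂ)
          (hpos1 : ∀ x : BondL2K ℂ d (towerP L m (n + 1)) c₀ W, x ≠ 0 →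
            0 < RCLike.re ⟪x, laplaceAk L m n φ η (fun _ : Bond d (towerP L m (n + 1)) => (1 : 𝔸ˣ)) hL (fun _ => 0) (fun _ => by norm_num)
              (perCfg_UlevOf_one_mem_U1 L m (n + 1)) (norm_Wcx_UlevOf_one_sub_one_le L m (n + 1) (fun _ => 0) (fun _ => le_rfl)) τ
              (c₀ := c₀) (c₁ := c₁) a x⟫_ℂ)
          (hQU : Function.Surjective (QkW L m n φ U hL αU hα1 hU1 hreg (c₀ := c₀) (c₁ := c₁)))
          (hQ1 : Function.Surjective (QkW L m n φ (fun _ : Bond d (towerP L m (n + 1)) => (1 : 𝔸ˣ)) hL (fun _ => 0) (fun _ => by norm_num)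
            (perCfg_UlevOf_one_mem_U1 L m (n + 1)) (norm_Wcx_UlevOf_one_sub_one_le L m (n + 1) (fun _ => 0) (fun _ => le_rfl)) (c₀ := c₀) (c₁ := c₁))),
        -- [G] the Green's function `G_k(U)`: bounds and Lipschitz rows at the flat point
        (∀ y : BondL2K ℂ d (towerP L m (n + 1)) c₀ W,
          ‖greenK (laplaceAk L m n φ η U hL αU hα1 hU1 hreg τ (c₀ := c₀) (c₁ := c₁) a) hposU y‖ ≤ C * ‖y‖ ∧
          ‖covCurlL2K ℂ c₀ ((η : ℂ))⁻¹ (adTransportW φ (fun _ : Bond d (towerP L m (n + 1)) => (1 : 𝔸ˣ)))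
            (greenK (laplaceAk L m n φ η U hL αU hα1 hU1 hreg τ (c₀ := c₀) (c₁ := c₁) a) hposU y)‖ ≤ C * ‖y‖ ∧
          ‖covDivL2K ℂ c₀ ((η : ℂ))⁻¹ (adTransportW φ fun _ : Bond d (towerP L m (n + 1)) => (1 : 𝔸ˣ)⁻¹)
            (greenK (laplaceAk L m n φ η U hL αU hα1 hU1 hreg τ (c₀ := c₀) (c₁ := c₁) a) hposU y)‖ ≤ C * ‖y‖ ∧
          ‖greenK (laplaceAk L m n φ η U hL αU hα1 hU1 hreg τ (c₀ := c₀) (c₁ := c₁) a) hposU y -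
            greenK (laplaceAk L m n φ η (fun _ : Bond d (towerP L m (n + 1)) => (1 : 𝔸ˣ)) hL (fun _ => 0) (fun _ => by norm_num)
              (perCfg_UlevOf_one_mem_U1 L m (n + 1)) (norm_Wcx_UlevOf_one_sub_one_le L m (n + 1) (fun _ => 0) (fun _ => le_rfl)) τ
              (c₀ := c₀) (c₁ := c₁) a) hpos1 y‖ ≤ C * α * ‖y‖ ∧
          ‖covCurlL2K ℂ c₀ ((η : ℂ))⁻¹ (adTransportW φ (fun _ : Bond d (towerP L m (n + 1)) => (1 : 𝔸ˣ)))
            (greenK (laplaceAk L m n φ η U hL αU hα1 hU1 hreg τ (c₀ := c₀) (c₁ := c₁) a) hposU y -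
            greenK (laplaceAk L m n φ η (fun _ : Bond d (towerP L m (n + 1)) => (1 : 𝔸ˣ)) hL (fun _ => 0) (fun _ => by norm_num)
              (perCfg_UlevOf_one_mem_U1 L m (n + 1)) (norm_Wcx_UlevOf_one_sub_one_le L m (n + 1) (fun _ => 0) (fun _ => le_rfl)) τ
              (c₀ := c₀) (c₁ := c₁) a) hpos1 y)‖ ≤ C * α * ‖y‖ ∧
          ‖covDivL2K ℂ c₀ ((η : ℂ))⁻¹ (adTransportW φ fun _ : Bond d (towerP L m (n + 1)) => (1 : 𝔸ˣ)⁻¹)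
            (greenK (laplaceAk L m n φ η U hL αU hα1 hU1 hreg τ (c₀ := c₀) (c₁ := c₁) a) hposU y -
            greenK (laplaceAk L m n φ η (fun _ : Bond d (towerP L m (n + 1)) => (1 : 𝔸ˣ)) hL (fun _ => 0) (fun _ => by norm_num)
              (perCfg_UlevOf_one_mem_U1 L m (n + 1)) (norm_Wcx_UlevOf_one_sub_one_le L m (n + 1) (fun _ => 0) (fun _ => le_rfl)) τ
              (c₀ := c₀) (c₁ := c₁) a) hpos1 y)‖ ≤ C * α * ‖y‖) ∧
        -- [HQG] the middle piece of (3.153): rows of `H_k(U)Q_k(U)G_k(U)`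
        (∀ y : BondL2K ℂ d (towerP L m (n + 1)) c₀ W,
          ‖H1LatticeK hposU hQU (QkW L m n φ U hL αU hα1 hU1 hreg (c₁ := c₁) (G1LatticeK hposU y))‖ ≤ C * ‖y‖ ∧
          ‖covCurlL2K ℂ c₀ ((η : ℂ))⁻¹ (adTransportW φ (fun _ : Bond d (towerP L m (n + 1)) => (1 : 𝔸ˣ)))
              (H1LatticeK hposU hQU (QkW L m n φ U hL αU hα1 hU1 hreg (c₁ := c₁) (G1LatticeK hposU y)))‖ ≤ C * ‖y‖ ∧
          ‖covDivL2K ℂ c₀ ((η : ℂ))⁻¹ (adTransportW φ fun _ : Bond d (towerP L m (n + 1)) => (1 : 𝔸ˣ)⁻¹)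
              (H1LatticeK hposU hQU (QkW L m n φ U hL αU hα1 hU1 hreg (c₁ := c₁) (G1LatticeK hposU y)))‖ ≤ C * ‖y‖) ∧
        -- [𝔊] the third Green's letter `𝔊_k(U)`: bounds and Lipschitz rows at the flat point
        (∀ x : BondL2K ℂ d (towerP L m (n + 1)) c₀ W,
          ‖frakGLatticeK hposU hQU x‖ ≤ C * ‖x‖ ∧
          ‖covCurlL2K ℂ c₀ ((η : ℂ))⁻¹ (adTransportW φ (fun _ : Bond d (towerP L m (n + 1)) => (1 : 𝔸ˣ))) (frakGLatticeK hposU hQU x)‖ ≤ C * ‖x‖ ∧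
          ‖covDivL2K ℂ c₀ ((η : ℂ))⁻¹ (adTransportW φ fun _ : Bond d (towerP L m (n + 1)) => (1 : 𝔸ˣ)⁻¹) (frakGLatticeK hposU hQU x)‖ ≤ C * ‖x‖ ∧
          ‖frakGLatticeK hposU hQU x - frakGLatticeK (c := ((η : ℂ))⁻¹) (R := adTransportW φ (fun _ : Bond d (towerP L m (n + 1)) => (1 : 𝔸ˣ)))
              (S := adTransportW φ fun _ : Bond d (towerP L m (n + 1)) => (1 : 𝔸ˣ)⁻¹) (Δ₁ := hessOp φ η (fun _ : Bond d (towerP L m (n + 1)) => (1 : 𝔸ˣ)) τ)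
              (Rr := RofUk L m n φ η (fun _ : Bond d (towerP L m (n + 1)) => (1 : 𝔸ˣ)))
              (Q := (QkW L m n φ (fun _ : Bond d (towerP L m (n + 1)) => (1 : 𝔸ˣ)) hL (fun _ => 0) (fun _ => by norm_num)
            (perCfg_UlevOf_one_mem_U1 L m (n + 1)) (norm_Wcx_UlevOf_one_sub_one_le L m (n + 1) (fun _ => 0) (fun _ => le_rfl)) (c₀ := c₀) (c₁ := c₁))) (a := a) hpos1 hQ1 x‖ ≤ C * α * ‖x‖ ∧
          ‖covCurlL2K ℂ c₀ ((η : ℂ))⁻¹ (adTransportW φ (fun _ : Bond d (towerP L m (n + 1)) => (1 : 𝔸ˣ)))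
            (frakGLatticeK hposU hQU x - frakGLatticeK (c := ((η : ℂ))⁻¹) (R := adTransportW φ (fun _ : Bond d (towerP L m (n + 1)) => (1 : 𝔸ˣ)))
              (S := adTransportW φ fun _ : Bond d (towerP L m (n + 1)) => (1 : 𝔸ˣ)⁻¹) (Δ₁ := hessOp φ η (fun _ : Bond d (towerP L m (n + 1)) => (1 : 𝔸ˣ)) τ)
              (Rr := RofUk L m n φ η (fun _ : Bond d (towerP L m (n + 1)) => (1 : 𝔸ˣ)))
              (Q := (QkW L m n φ (fun _ : Bond d (towerP L m (n + 1)) => (1 : 𝔸ˣ)) hL (fun _ => 0) (fun _ => by norm_num)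
            (perCfg_UlevOf_one_mem_U1 L m (n + 1)) (norm_Wcx_UlevOf_one_sub_one_le L m (n + 1) (fun _ => 0) (fun _ => le_rfl)) (c₀ := c₀) (c₁ := c₁))) (a := a) hpos1 hQ1 x)‖ ≤ C * α * ‖x‖ ∧
          ‖covDivL2K ℂ c₀ ((η : ℂ))⁻¹ (adTransportW φ fun _ : Bond d (towerP L m (n + 1)) => (1 : 𝔸ˣ)⁻¹)
            (frakGLatticeK hposU hQU x - frakGLatticeK (c := ((η : ℂ))⁻¹) (R := adTransportW φ (fun _ : Bond d (towerP L m (n + 1)) => (1 : 𝔸ˣ)))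
              (S := adTransportW φ fun _ : Bond d (towerP L m (n + 1)) => (1 : 𝔸ˣ)⁻¹) (Δ₁ := hessOp φ η (fun _ : Bond d (towerP L m (n + 1)) => (1 : 𝔸ˣ)) τ)
              (Rr := RofUk L m n φ η (fun _ : Bond d (towerP L m (n + 1)) => (1 : 𝔸ˣ)))
              (Q := (QkW L m n φ (fun _ : Bond d (towerP L m (n + 1)) => (1 : 𝔸ˣ)) hL (fun _ => 0) (fun _ => by norm_num)
            (perCfg_UlevOf_one_mem_U1 L m (n + 1)) (norm_Wcx_UlevOf_one_sub_one_le L m (n + 1) (fun _ => 0) (fun _ => le_rfl)) (c₀ := c₀) (c₁ := c₁))) (a := a) hpos1 hQ1 x)‖ ≤ C * α * ‖x‖) ∧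
        -- [H] the minimiser `H_k(U)`: bounds and Lipschitz rows at the flat point
        (∀ b : BondL2K ℂ d m c₁ W,
          ‖H1LatticeK hposU hQU b‖ ≤ C * ‖b‖ ∧
          ‖covCurlL2K ℂ c₀ ((η : ℂ))⁻¹ (adTransportW φ (fun _ : Bond d (towerP L m (n + 1)) => (1 : 𝔸ˣ))) (H1LatticeK hposU hQU b)‖ ≤ C * ‖b‖ ∧
          ‖covDivL2K ℂ c₀ ((η : ℂ))⁻¹ (adTransportW φ fun _ : Bond d (towerP L m (n + 1)) => (1 : 𝔸ˣ)⁻¹) (H1LatticeK hposU hQU b)‖ ≤ C * ‖b‖ ∧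
          ‖H1LatticeK hposU hQU b - H1LatticeK (c := ((η : ℂ))⁻¹) (R := adTransportW φ (fun _ : Bond d (towerP L m (n + 1)) => (1 : 𝔸ˣ)))
              (S := adTransportW φ fun _ : Bond d (towerP L m (n + 1)) => (1 : 𝔸ˣ)⁻¹) (Δ₁ := hessOp φ η (fun _ : Bond d (towerP L m (n + 1)) => (1 : 𝔸ˣ)) τ)
              (Rr := RofUk L m n φ η (fun _ : Bond d (towerP L m (n + 1)) => (1 : 𝔸ˣ)))
              (Q := (QkW L m n φ (fun _ : Bond d (towerP L m (n + 1)) => (1 : 𝔸ˣ)) hL (fun _ => 0) (fun _ => by norm_num)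
            (perCfg_UlevOf_one_mem_U1 L m (n + 1)) (norm_Wcx_UlevOf_one_sub_one_le L m (n + 1) (fun _ => 0) (fun _ => le_rfl)) (c₀ := c₀) (c₁ := c₁))) (a := a) hpos1 hQ1 b‖ ≤ C * α * ‖b‖ ∧
          ‖covCurlL2K ℂ c₀ ((η : ℂ))⁻¹ (adTransportW φ (fun _ : Bond d (towerP L m (n + 1)) => (1 : 𝔸ˣ)))
            (H1LatticeK hposU hQU b - H1LatticeK (c := ((η : ℂ))⁻¹) (R := adTransportW φ (fun _ : Bond d (towerP L m (n + 1)) => (1 : 𝔸ˣ)))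
              (S := adTransportW φ fun _ : Bond d (towerP L m (n + 1)) => (1 : 𝔸ˣ)⁻¹) (Δ₁ := hessOp φ η (fun _ : Bond d (towerP L m (n + 1)) => (1 : 𝔸ˣ)) τ)
              (Rr := RofUk L m n φ η (fun _ : Bond d (towerP L m (n + 1)) => (1 : 𝔸ˣ)))
              (Q := (QkW L m n φ (fun _ : Bond d (towerP L m (n + 1)) => (1 : 𝔸ˣ)) hL (fun _ => 0) (fun _ => by norm_num)
            (perCfg_UlevOf_one_mem_U1 L m (n + 1)) (norm_Wcx_UlevOf_one_sub_one_le L m (n + 1) (fun _ => 0) (fun _ => le_rfl)) (c₀ := c₀) (c₁ := c₁))) (a := a) hpos1 hQ1 b)‖ ≤ C * α * ‖b‖ ∧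
          ‖covDivL2K ℂ c₀ ((η : ℂ))⁻¹ (adTransportW φ fun _ : Bond d (towerP L m (n + 1)) => (1 : 𝔸ˣ)⁻¹)
            (H1LatticeK hposU hQU b - H1LatticeK (c := ((η : ℂ))⁻¹) (R := adTransportW φ (fun _ : Bond d (towerP L m (n + 1)) => (1 : 𝔸ˣ)))
              (S := adTransportW φ fun _ : Bond d (towerP L m (n + 1)) => (1 : 𝔸ˣ)⁻¹) (Δ₁ := hessOp φ η (fun _ : Bond d (towerP L m (n + 1)) => (1 : 𝔸ˣ)) τ)
              (Rr := RofUk L m n φ η (fun _ : Bond d (towerP L m (n + 1)) => (1 : 𝔸ˣ)))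
              (Q := (QkW L m n φ (fun _ : Bond d (towerP L m (n + 1)) => (1 : 𝔸ˣ)) hL (fun _ => 0) (fun _ => by norm_num)
            (perCfg_UlevOf_one_mem_U1 L m (n + 1)) (norm_Wcx_UlevOf_one_sub_one_le L m (n + 1) (fun _ => 0) (fun _ => le_rfl)) (c₀ := c₀) (c₁ := c₁))) (a := a) hpos1 hQ1 b)‖ ≤ C * α * ‖b‖) := by
  -- the ten suppliers, `∃`-first, BY NAME
  obtain ⟨αG, γG, hαG, hγG, HG⟩ := exists_norm_G1k_le_diagonal_closed (d := d) L hL φ hMφ hMφ' hφ hφ' ha hr0 hr1 τ hτ hCτ hρw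
  obtain ⟨αGr, CGr, hαGr, hCGr, HGr⟩ := exists_norm_G1k_rows_le_diagonal_closed (d := d) L hL φ hMφ hMφ' hφ hφ' ha hr0 hr1 τ hτ hCτ hρw
  obtain ⟨αM, CM, hαM, hCM, HM⟩ := exists_norm_H1k_Qk_G1k_le_diagonal_closed (d := d) L hL φ hMφ hMφ' hφ hφ' ha hr0 hr1 τ hτ hCτ hρw
  obtain ⟨αF, CF, hαF, hCF, HF⟩ := exists_norm_frakGk_le_diagonal_closed (d := d) L hL φ hMφ hMφ' hφ hφ' ha hr0 hr1 τ hτ hCτ hρw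
  obtain ⟨αE, γ₁, hαE, hγ₁, HE⟩ := exists_energy_letters_diagonal_closed (d := d) L hL φ hMφ hMφ' hφ hφ' ha hr0 hr1 τ hτ hCτ hρw
  obtain ⟨αK, CKU, CH, hαK, hCKU, hCH, HK⟩ :=
    exists_norm_KinvLatticeK_H1LatticeK_le_diagonal_closed hd L hL φ hMφ hMφ' hφ hφ' ha hr0 hr1 τ hτ hCτ hρw hτ₁ hτ₂ hφτ
  obtain ⟨αGL, CGL, hαGL, hCGL, HGL⟩ := exists_norm_G1k_sub_flat_le_diagonal_letterfree (d := d) L hL φ hMφ hMφ' hφ hφ' ha hr0 hr1 τ hτ hCτ hρw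
  obtain ⟨αR, CR, hαR, hCR, HR⟩ := exists_norm_RofUk_sub_RofUk_one_le_diagonal (d := d) L φ hMφ hMφ' hφ hφ' hr0 hr1
  obtain ⟨αHL, CHL, hαHL, hCHL, HHL⟩ :=
    exists_norm_H1k_sub_flat_le_closed hd L hL φ hMφ hMφ' hφ hφ' ha hr0 hr1 τ hτ hCτ hρw hCR.le hτ₁ hτ₂ hφτ
  obtain ⟨αFL, CFL, hαFL, hCFL, HFL⟩ :=
    exists_norm_frakGk_sub_flat_le_closed hd L hL φ hMφ hMφ' hφ hφ' ha hr0 hr1 τ hτ hCτ hρw hCR.le hτ₁ hτ₂ hφτ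
  -- the energy row constant of `H_k(U)`
  obtain ⟨CHr, hCHrdef⟩ : ∃ CHr : ℝ, CHr = Real.sqrt (CKU / γ₁) := ⟨_, rfl⟩
  have hCHr : 0 ≤ CHr := by rw [hCHrdef]; exact Real.sqrt_nonneg _
  -- one ceiling, one constant
  obtain ⟨C, hCdef⟩ : ∃ C : ℝ, C = γG⁻¹ + CGr + CM + CF + CH + CHr + CGL + CHL + CFL := ⟨_, rfl⟩
  have hγG' : 0 ≤ γG⁻¹ := inv_nonneg.2 hγG.le
  have h1 : γG⁻¹ ≤ C := by rw [hCdef]; linarith [hCGr.le, hCM.le, hCF.le, hCH.le, hCGL.le, hCHL.le, hCFL.le]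
  have h2 : CGr ≤ C := by rw [hCdef]; linarith [hCM.le, hCF.le, hCH.le, hCGL.le, hCHL.le, hCFL.le]
  have h3 : CM ≤ C := by rw [hCdef]; linarith [hCGr.le, hCF.le, hCH.le, hCGL.le, hCHL.le, hCFL.le]
  have h4 : CF ≤ C := by rw [hCdef]; linarith [hCGr.le, hCM.le, hCH.le, hCGL.le, hCHL.le, hCFL.le]
  have h5 : CH ≤ C := by rw [hCdef]; linarith [hCGr.le, hCM.le, hCF.le, hCGL.le, hCHL.le, hCFL.le]
  have h6 : CHr ≤ C := by rw [hCdef]; linarith [hCGr.le, hCM.le, hCF.le, hCH.le, hCGL.le, hCHL.le, hCFL.le]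
  have h7 : CGL ≤ C := by rw [hCdef]; linarith [hCGr.le, hCM.le, hCF.le, hCH.le, hCHL.le, hCFL.le]
  have h8 : CHL ≤ C := by rw [hCdef]; linarith [hCGr.le, hCM.le, hCF.le, hCH.le, hCGL.le, hCFL.le]
  have h9 : CFL ≤ C := by rw [hCdef]; linarith [hCGr.le, hCM.le, hCF.le, hCH.le, hCGL.le, hCHL.le]
  have hC : 0 < C := lt_of_lt_of_le hCGr h2
  refine ⟨min (min (min (min αG αGr) (min αM αF)) (min (min αE αK) (min αGL αR))) (min αHL αFL), C,
    lt_min (lt_min (lt_min (lt_min hαG hαGr) (lt_min hαM hαF)) (lt_min (lt_min hαE hαK) (lt_min hαGL hαR))) (lt_min hαHL hαFL), hC, ?_⟩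
  intro n η hηL hL3 c₀ c₁ _ _ hw hρ m _ U αU hα1 hU1 hreg εU hεU hUε α hα0 hαle hUst hUb hUη hpl hεg hposU hpos1 hQU hQ1
  -- the ten ceilings
  have hαG' : α ≤ αG := hαle.trans ((min_le_left _ _).trans ((min_le_left _ _).trans ((min_le_left _ _).trans (min_le_left _ _))))
  have hαGr' : α ≤ αGr := hαle.trans ((min_le_left _ _).trans ((min_le_left _ _).trans ((min_le_left _ _).trans (min_le_right _ _))))
  have hαM' : α ≤ αM := hαle.trans ((min_le_left _ _).trans ((min_le_left _ _).trans ((min_le_right _ _).trans (min_le_left _ _))))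
  have hαF' : α ≤ αF := hαle.trans ((min_le_left _ _).trans ((min_le_left _ _).trans ((min_le_right _ _).trans (min_le_right _ _))))
  have hαE' : α ≤ αE := hαle.trans ((min_le_left _ _).trans ((min_le_right _ _).trans ((min_le_left _ _).trans (min_le_left _ _))))
  have hαK' : α ≤ αK := hαle.trans ((min_le_left _ _).trans ((min_le_right _ _).trans ((min_le_left _ _).trans (min_le_right _ _))))
  have hαGL' : α ≤ αGL := hαle.trans ((min_le_left _ _).trans ((min_le_right _ _).trans ((min_le_right _ _).trans (min_le_left _ _))))
  have hαR' : α ≤ αR := hαle.trans ((min_le_left _ _).trans ((min_le_right _ _).trans ((min_le_right _ _).trans (min_le_right _ _))))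
  have hαHL' : α ≤ αHL := hαle.trans ((min_le_right _ _).trans (min_le_left _ _))
  have hαFL' : α ≤ αFL := hαle.trans ((min_le_right _ _).trans (min_le_right _ _))
  -- `hRS`, the symmetry of `Δ_a(U)`, the averaged configurations in `U1`, the `R`-letter
  have hRS : ∀ (b : Bond d (towerP L m (n + 1))) (v u : W), ⟪adTransportW φ U b v, u⟫_ℂ = ⟪v, adTransportW φ (fun b => (U b)⁻¹) b u⟫_ℂ :=
    adTransportW_adjoint φ τ hτ₂ hUst hφτ
  have hsymm := laplaceAk_isSymmetric L m n φ η U hL αU hα1 hU1 hreg τ (c₀ := c₀) (c₁ := c₁) hUst hτ₁ hτ₂ hφτ a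
  have hLb := hLb_of_hU1 L m n U hU1
  have hR : ∀ s : SiteL2K ℂ d (towerP L m (n + 1)) c₀ W,
      ‖RofUk L m n φ η U s - RofUk L m n φ η (fun _ : Bond d (towerP L m (n + 1)) => (1 : 𝔸ˣ)) s‖ ≤ CR * α * ‖s‖ :=
    fun s => HR n η hηL c₀ c₁ hw m U εU hεU hUε hLb hα0 hαR' hRS hUb hUη hεg s
  refine ⟨?_, ?_, ?_, ?_⟩
  · -- [G]
    intro y
    have hm := HG n η hηL c₀ c₁ hw hρ m U αU hα1 hU1 hreg εU hεU hUε hα0 hαG' hRS hUb hUη hpl hεg hposU y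
    have hr' := HGr n η hηL c₀ c₁ hw hρ m U αU hα1 hU1 hreg εU hεU hUε hα0 hαGr' hRS hUb hUη hpl hεg hposU y
    have hl := HGL n η hηL c₀ c₁ hw hρ m U αU hα1 hU1 hreg εU hεU hUε hα0 hαGL' hRS hUb hUη hpl hεg hposU hpos1 y
    exact ⟨row_mono hm h1 (norm_nonneg _), row_mono hr'.1 h2 (norm_nonneg _), row_mono hr'.2 h2 (norm_nonneg _),
      row_mono_lin hl.1 h7 hα0 (norm_nonneg _), row_mono_lin hl.2.1 h7 hα0 (norm_nonneg _), row_mono_lin hl.2.2 h7 hα0 (norm_nonneg _)⟩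
  · -- [HQG]
    intro y
    have hm := HM n η hηL c₀ c₁ hw hρ m U αU hα1 hU1 hreg εU hεU hUε hα0 hαM' hRS hUb hUη hpl hεg hsymm hposU hQU y
    exact ⟨row_mono hm.1 h3 (norm_nonneg _), row_mono hm.2.1 h3 (norm_nonneg _), row_mono hm.2.2 h3 (norm_nonneg _)⟩
  · -- [𝔊]
    intro x
    have hb := HF n η hηL c₀ c₁ hw hρ m U αU hα1 hU1 hreg εU hεU hUε hα0 hαF' hRS hUb hUη hpl hεg hsymm hposU hQU x
    have hl := HFL n η hηL hL3 c₀ c₁ hw hρ m U αU hα1 hU1 hreg εU hεU hUε hα0 hαFL' hUst hUb hUη hpl hεg hR hposU hpos1 hQU hQ1 x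
    exact ⟨row_mono hb.1 h4 (norm_nonneg _), row_mono hb.2.1 h4 (norm_nonneg _), row_mono hb.2.2 h4 (norm_nonneg _),
      row_mono_lin hl.1 h9 hα0 (norm_nonneg _), row_mono_lin hl.2.1 h9 hα0 (norm_nonneg _), row_mono_lin hl.2.2 h9 hα0 (norm_nonneg _)⟩
  · -- [H]
    intro b
    have hKH := HK n η hηL hL3 c₀ c₁ hw hρ m U αU hα1 hU1 hreg εU hεU hUε hα0 hαK' hUst hUb hUη hpl hεg hposU hQU
    have hl := HHL n η hηL hL3 c₀ c₁ hw hρ m U αU hα1 hU1 hreg εU hεU hUε hα0 hαHL' hUst hUb hUη hpl hεg hR hposU hpos1 hQU hQ1 b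
    -- the energy rows of `H_k(U)b`: the flat energy weight `N₁`, the strong coercivity at `U`, `weight_H1K_le`
    obtain ⟨N, hNdef⟩ : ∃ N : BondL2K ℂ d (towerP L m (n + 1)) c₀ W → ℝ, N = fun z =>
        Real.sqrt (‖covCurlL2K ℂ c₀ ((η : ℂ))⁻¹ (adTransportW φ (fun _ : Bond d (towerP L m (n + 1)) => (1 : 𝔸ˣ))) z‖ ^ 2 +
          ‖covDivL2K ℂ c₀ ((η : ℂ))⁻¹ (adTransportW φ fun _ : Bond d (towerP L m (n + 1)) => (1 : 𝔸ˣ)⁻¹) z‖ ^ 2 + ‖z‖ ^ 2) := ⟨_, rfl⟩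
    have hNz : ∀ z, N z = Real.sqrt (‖covCurlL2K ℂ c₀ ((η : ℂ))⁻¹ (adTransportW φ (fun _ : Bond d (towerP L m (n + 1)) => (1 : 𝔸ˣ))) z‖ ^ 2 +
          ‖covDivL2K ℂ c₀ ((η : ℂ))⁻¹ (adTransportW φ fun _ : Bond d (towerP L m (n + 1)) => (1 : 𝔸ˣ)⁻¹) z‖ ^ 2 + ‖z‖ ^ 2) := fun z => by rw [hNdef]
    have hN0 : ∀ z, 0 ≤ N z := fun z => by rw [hNz]; exact Real.sqrt_nonneg _
    have hNsq : ∀ z, N z ^ 2 = ‖covCurlL2K ℂ c₀ ((η : ℂ))⁻¹ (adTransportW φ (fun _ : Bond d (towerP L m (n + 1)) => (1 : 𝔸ˣ))) z‖ ^ 2 +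
          ‖covDivL2K ℂ c₀ ((η : ℂ))⁻¹ (adTransportW φ fun _ : Bond d (towerP L m (n + 1)) => (1 : 𝔸ˣ)⁻¹) z‖ ^ 2 + ‖z‖ ^ 2 := fun z => by
      rw [hNz]; exact Real.sq_sqrt (add_nonneg (add_nonneg (sq_nonneg _) (sq_nonneg _)) (sq_nonneg _))
    have hNc : ∀ z, ‖covCurlL2K ℂ c₀ ((η : ℂ))⁻¹ (adTransportW φ (fun _ : Bond d (towerP L m (n + 1)) => (1 : 𝔸ˣ))) z‖ ≤ N z := fun z => by
      rw [hNz]; exact le_sqrt_of_sq_le (norm_nonneg _) ((le_add_of_nonneg_right (sq_nonneg _)).trans (le_add_of_nonneg_right (sq_nonneg _)))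
    have hNd : ∀ z, ‖covDivL2K ℂ c₀ ((η : ℂ))⁻¹ (adTransportW φ fun _ : Bond d (towerP L m (n + 1)) => (1 : 𝔸ˣ)⁻¹) z‖ ≤ N z := fun z => by
      rw [hNz]; exact le_sqrt_of_sq_le (norm_nonneg _) ((le_add_of_nonneg_left (sq_nonneg _)).trans (le_add_of_nonneg_right (sq_nonneg _)))
    have hcoerU : ∀ z, γ₁ * N z ^ 2 ≤ RCLike.re ⟪z, laplaceAk L m n φ η U hL αU hα1 hU1 hreg τ (c₀ := c₀) (c₁ := c₁) a z⟫_ℂ := fun z => by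
      rw [hNsq]; exact (HE n η hηL c₀ c₁ hw hρ m U αU hα1 hU1 hreg εU hεU hUε hα0 hαE' hRS hUb hUη hpl hεg z).1
    have hadjU : ∀ (x : BondL2K ℂ d (towerP L m (n + 1)) c₀ W) (z : BondL2K ℂ d m c₁ W),
        ⟪(QkW L m n φ U hL αU hα1 hU1 hreg (c₀ := c₀) (c₁ := c₁)) x, z⟫_ℂ = ⟪x, LinearMap.adjoint (QkW L m n φ U hL αU hα1 hU1 hreg (c₀ := c₀) (c₁ := c₁)) z⟫_ℂ :=
      fun x z => (LinearMap.adjoint_inner_right _ x z).symm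
    have hinjU := adjoint_injective_of_surjective _ hQU
    have hw' : N (H1LatticeK hposU hQU b) ≤ CHr * ‖b‖ := by
      rw [hCHrdef]
      exact weight_H1K_le (𝕜 := ℂ) hposU hadjU hinjU N hN0 hγ₁ hCKU.le hcoerU hKH.1 b
    exact ⟨row_mono (hKH.2 b) h5 (norm_nonneg _), row_mono ((hNc _).trans hw') h6 (norm_nonneg _), row_mono ((hNd _).trans hw') h6 (norm_nonneg _),
      row_mono_lin hl.1 h8 hα0 (norm_nonneg _), row_mono_lin hl.2.1 h8 hα0 (norm_nonneg _), row_mono_lin hl.2.2 h8 hα0 (norm_nonneg _)⟩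

end Literature.MathematicalPhysics.QuantumFieldTheory.Balaban1983to89.B9Eq3126EnergyBallTowerClosed

end
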